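import Literature.NumberTheory.EllipticCurves.TwoDescentLocalTwo
import Summits.BirchSwinnertonDyer.BirchSwinnertonDyer.Theorems.Rank2ObservatoryTwoDescentLocalMultDeep
import HarnessLib

/-!
# Rank-2 observatory — a `2`-adic parity condition of the complete `2`-descent when two roots are
# congruent modulo exactly `16` (good reduction at `2` after the non-minimal twist)

HONEST FRAMING: per-curve certified theorems and census instruments; no claim on BSD in rank ≥ 2.

Setting: `y² = (x - e₁)(x - e₂)(x - e₃)` with integer roots, `e₁ - e₂` and `e₁ - e₃` odd (so `e₁` is the
root isolated modulo `2`), `e₂ - e₁ ≡ 1 (mod 4)` and `v₂(e₂ - e₃) = 4` exactly. (After `x = 4x'`,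
`y = 8y' + …` this is a curve with GOOD reduction at `2`; the observatory's mined table of `2`-adic images,
`kernel-hup/two_adic_law_00m.txt`, shows that in exactly this configuration the parity of `v₂(x - e₂)` is
one of the three linear conditions cutting out `E(ℚ₂)/2E(ℚ₂)`.) This file proves it for RATIONAL points:
for every `(x, y) ∈ E(ℚ)`, `y ≠ 0`, `v₂(x - e₂)` is even (`even_padicValRat_sub_of_two_good`), and hence so
is `v₂(x - e₃)` (`even_padicValRat_sub_of_two_good'`; `v₂(x - e₁)` is even by part (I) of
`local_conditions_of_mult_deep`, which holds at `p = 2`).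

Proof (elementary, Silverman AEC X.1 style, residues mod `8` from `TwoDescentLocalTwo`): if
`v₂(x - e₁) < 0` all three factors have that (even) valuation; if `v₂(x - e₁) > 0` then `x - e₂` is a
`2`-adic unit; if `v₂(x - e₁) = 0` put `t = v₂(x - e₂) ≥ 0`: for `t > 4`, `v₂(x - e₃) = 4` and the parity
of `y²` makes `t` even; `t = 4` is even; for `t ∈ {1, 3}` the residues `res8 (x - e₁) = (e₂ - e₁) + 2^t r`,
`res8 (x - e₃) = r + 2^(4-t) c` (`r = res8 (x - e₂)`, `c = res8 (e₂ - e₃)`) and the square relation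
`res8 (x - e₁) · r · res8 (x - e₃) = 1` are contradictory in `ℤ/8` because `e₂ - e₁ ≡ 1 (mod 4)`.

## References

* J. H. Silverman, *The Arithmetic of Elliptic Curves*, 2nd ed., GTM 106 (2009), Prop. X.1.4,
  Example X.1.5. [SilvermanAEC2009]
* J. E. Cremona, *Algorithms for Modular Elliptic Curves*, 2nd ed. (1997), Sec. 3.6. [CremonaAlgorithms1997]
-/

noncomputable section

open scoped Classical

set_option linter.dupNamespace false

namespace Summit.BirchSwinnertonDyer.BirchSwinnertonDyer.Rank2Observatory

open Literature.NumberTheory.EllipticCurves.TwoDescentLocal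
open Literature.NumberTheory.EllipticCurves.KramerTwoDescent

variable {e₁ e₂ e₃ : ℤ} {x y : ℚ}

/-- Finite checks in `ℤ/8` behind the two impossible sub-cases `t = 1`, `t = 3`. [folklore] -/
theorem zmod8_good_aux :
    (∀ r s c : ZMod (2 ^ 3), r * r = 1 → (s = 1 ∨ s = 5) →
      (s + (2 : ZMod (2 ^ 3)) ^ 1 * r) * r * (r + (2 : ZMod (2 ^ 3)) ^ 3 * c) ≠ 1) ∧
    (∀ r s c : ZMod (2 ^ 3), r * r = 1 → c * c = 1 → (s = 1 ∨ s = 5) →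
      (s + (2 : ZMod (2 ^ 3)) ^ 3 * r) * r * (r + (2 : ZMod (2 ^ 3)) ^ 1 * c) ≠ 1) ∧
    (∀ q : ZMod (2 ^ 3), 4 * q + 1 = 1 ∨ 4 * q + 1 = 5) := by
  refine ⟨by decide, by decide, by decide⟩

/-- **`2`-adic parity at a `v₂ = 4` congruence (good reduction at `2`).** If `e₁ - e₂`, `e₁ - e₃` are odd,
`e₂ - e₁ ≡ 1 (mod 4)` and `v₂(e₂ - e₃) = 4`, then for every rational point `(x, y)`, `y ≠ 0`, of
`y² = (x - e₁)(x - e₂)(x - e₃)` the valuation `v₂(x - e₂)` is even.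
[cite: SilvermanAEC2009, Prop. X.1.4, Example X.1.5] -/
theorem even_padicValRat_sub_of_two_good (h₁₂ : ¬ (2 : ℤ) ∣ e₁ - e₂) (h₁₃ : ¬ (2 : ℤ) ∣ e₁ - e₃)
    (h4 : (4 : ℤ) ∣ e₂ - e₁ - 1) (h₂₃ : padicValRat 2 ((e₂ : ℚ) - e₃) = 4)
    (hy : y ≠ 0) (h : y ^ 2 = (x - e₁) * (x - e₂) * (x - e₃)) :
    Even (padicValRat 2 (x - e₂)) := by
  obtain ⟨hd₁, hd₂, hd₃⟩ := factors_ne_zero hy h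
  have ha0 : ((e₂ : ℚ) - e₁) ≠ 0 := by
    have : (e₂ - e₁ : ℤ) ≠ 0 := by rintro h0; exact h₁₂ ⟨0, by omega⟩
    exact_mod_cast this
  have ha0' : ((e₁ : ℚ) - e₂) ≠ 0 := by
    intro h0; exact ha0 (by linarith)
  have hva : padicValRat 2 ((e₂ : ℚ) - e₁) = 0 := by
    have := padicValRat_intCast_eq_zero (p := 2) (z := e₂ - e₁) (by intro hd; exact h₁₂ (by omega))
    push_cast at this; exact this
  have hva' : padicValRat 2 ((e₁ : ℚ) - e₂) = 0 := by
    rw [show ((e₁ : ℚ) - e₂) = -(((e₂ : ℚ) - e₁)) by ring, padicValRat.neg, hva]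
  have hb0 : ((e₂ : ℚ) - e₃) ≠ 0 := by
    intro h0; rw [h0, padicValRat.zero] at h₂₃; norm_num at h₂₃
  have hsum := even_sum_padicValRat (p := 2) hy h
  -- part (I) of the multiplicative lemma holds at `p = 2`: `v₂(x - e₁)` is even
  have hev₁ : Even (padicValRat 2 (x - e₁)) :=
    even_padicValRat_sub_of_mult_deep (p := 2) (m := 4) h₁₂ h₁₃ (by norm_num)
      (by rw [h₂₃]; rfl) hy h
  set v := padicValRat 2 (x - e₁) with hv
  set t := padicValRat 2 (x - e₂) with ht
  rcases lt_trichotomy v 0 with hneg | hzero | hpos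
  · -- `v₂(x - e₁) < 0`: `x - e₂ = (x - e₁) + (e₁ - e₂)` has the same valuation
    have : t = v := by
      rw [ht, show x - (e₂ : ℚ) = (x - e₁) + ((e₁ : ℚ) - e₂) by ring]
      exact (padicValRat_add_eq_left hd₁ (Or.inr (by rw [hva']; exact hneg))).2
    rw [this]; exact hev₁
  · -- `v₂(x - e₁) = 0`: compare `t = v₂(x - e₂) ≥ 0` with `4 = v₂(e₂ - e₃)`
    have ht0 : 0 ≤ t := by
      have := le_padicValRat_add_or (p := 2) (a := x - (e₁ : ℚ)) (b := ((e₁ : ℚ) - e₂)) (c := 0)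
        (Or.inr (by rw [← hv, hzero])) (Or.inr (by rw [hva']))
      rw [show (x - (e₁ : ℚ)) + ((e₁ : ℚ) - e₂) = x - e₂ by ring] at this
      exact this.resolve_left hd₂
    rcases Int.even_or_odd t with hte | hto
    · exact hte
    exfalso
    have ht4 : t ≠ 4 := by rintro h4'; rw [h4'] at hto; exact (by decide : ¬ Odd (4 : ℤ)) hto
    rcases lt_or_gt_of_ne ht4 with hlt | hgt
    · -- `t ∈ {1, 3}`: residues mod 8
      set r := res8 (x - (e₂ : ℚ)) with hr
      have hrr : r * r = 1 := res8_mul_self hd₂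
      set s := res8 ((e₂ : ℚ) - e₁) with hs
      set c := res8 ((e₂ : ℚ) - e₃) with hc
      have hcc : c * c = 1 := res8_mul_self hb0
      obtain ⟨aux1, aux3, aux4⟩ := zmod8_good_aux
      have hs15 : s = 1 ∨ s = 5 := by
        obtain ⟨q, hq⟩ := h4
        have hcast : res8 ((e₂ : ℚ) - e₁) = (((e₂ - e₁ : ℤ)) : ZMod (2 ^ 3)) := by
          have := res8_intCast (z := e₂ - e₁) (by intro hd; exact h₁₂ (by omega))
          push_cast at this ⊢; exact this
        rw [hs, hcast, show e₂ - e₁ = 4 * q + 1 by omega]; push_cast; exact aux4 _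
      have hprod : res8 (x - (e₁ : ℚ)) * r * res8 (x - (e₃ : ℚ)) = 1 := by
        have h1 : res8 (y ^ 2) = res8 (x - (e₁ : ℚ)) * r * res8 (x - (e₃ : ℚ)) := by
          rw [h, res8_mul (mul_ne_zero hd₁ hd₂) hd₃, res8_mul hd₁ hd₂]
        rw [← h1, res8_sq, sq, res8_mul_self hy]
      have hx₁ : x - (e₁ : ℚ) = ((e₂ : ℚ) - e₁) + (x - e₂) := by ring
      have hx₃ : x - (e₃ : ℚ) = (x - e₂) + ((e₂ : ℚ) - e₃) := by ring
      have h13 : t = 1 ∨ t = 3 := by obtain ⟨j, hj⟩ := hto; omega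
      rcases h13 with h1 | h3
      · have hr₁ : res8 (x - (e₁ : ℚ)) = s + (2 : ZMod (2 ^ 3)) ^ 1 * r := by
          rw [hx₁, res8_add_of_eq ha0 (k := 1) le_rfl (by rw [hva, ← ht, h1]; rfl)]
        have hr₃ : res8 (x - (e₃ : ℚ)) = r + (2 : ZMod (2 ^ 3)) ^ 3 * c := by
          rw [hx₃, res8_add_of_eq hd₂ (k := 3) (by norm_num) (by rw [h₂₃, ← ht, h1]; rfl)]
        rw [hr₁, hr₃] at hprod
        exact aux1 r s c hrr hs15 hprod
      · have hr₁ : res8 (x - (e₁ : ℚ)) = s + (2 : ZMod (2 ^ 3)) ^ 3 * r := by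
          rw [hx₁, res8_add_of_eq ha0 (k := 3) (by norm_num) (by rw [hva, ← ht, h3]; rfl)]
        have hr₃ : res8 (x - (e₃ : ℚ)) = r + (2 : ZMod (2 ^ 3)) ^ 1 * c := by
          rw [hx₃, res8_add_of_eq hd₂ (k := 1) le_rfl (by rw [h₂₃, ← ht, h3]; rfl)]
        rw [hr₁, hr₃] at hprod
        exact aux3 r s c hrr hcc hs15 hprod
    · -- `t > 4`: `v₂(x - e₃) = v₂(e₂ - e₃) = 4` and the parity of `y²` makes `t` even
      have hv₃ : padicValRat 2 (x - (e₃ : ℚ)) = 4 := by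
        rw [show x - (e₃ : ℚ) = ((e₂ : ℚ) - e₃) + (x - e₂) by ring]
        rw [(padicValRat_add_eq_left hb0 (Or.inr (by rw [h₂₃, ← ht]; exact hgt))).2, h₂₃]
      rw [hzero, hv₃] at hsum
      obtain ⟨k, hk⟩ := hsum; obtain ⟨j, hj⟩ := hto; omega
  · -- `v₂(x - e₁) > 0`: `x - e₂ = (e₁ - e₂) + (x - e₁)` is a `2`-adic unit
    have : t = 0 := by
      rw [ht, show x - (e₂ : ℚ) = ((e₁ : ℚ) - e₂) + (x - e₁) by ring]
      rw [(padicValRat_add_eq_left ha0' (Or.inr (by rw [hva', ← hv]; exact hpos))).2, hva']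
    rw [this]; exact ⟨0, rfl⟩

/-- Same setting: `v₂(x - e₃)` is even too (the parity of `y²` and the evenness of `v₂(x - e₁)`,
`v₂(x - e₂)`). [cite: SilvermanAEC2009, Prop. X.1.4, Example X.1.5] -/
theorem even_padicValRat_sub_of_two_good' (h₁₂ : ¬ (2 : ℤ) ∣ e₁ - e₂) (h₁₃ : ¬ (2 : ℤ) ∣ e₁ - e₃)
    (h4 : (4 : ℤ) ∣ e₂ - e₁ - 1) (h₂₃ : padicValRat 2 ((e₂ : ℚ) - e₃) = 4)
    (hy : y ≠ 0) (h : y ^ 2 = (x - e₁) * (x - e₂) * (x - e₃)) :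
    Even (padicValRat 2 (x - e₃)) := by
  obtain ⟨hd₁, hd₂, hd₃⟩ := factors_ne_zero hy h
  have hsum := even_sum_padicValRat (p := 2) hy h
  have hev₁ : Even (padicValRat 2 (x - e₁)) :=
    even_padicValRat_sub_of_mult_deep (p := 2) (m := 4) h₁₂ h₁₃ (by norm_num)
      (by rw [h₂₃]; rfl) hy h
  have hev₂ := even_padicValRat_sub_of_two_good h₁₂ h₁₃ h4 h₂₃ hy h
  obtain ⟨a, ha⟩ := hev₁; obtain ⟨b, hb⟩ := hev₂; obtain ⟨k, hk⟩ := hsum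
  exact ⟨k - a - b, by omega⟩

end Summit.BirchSwinnertonDyer.BirchSwinnertonDyer.Rank2Observatory
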